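import Summits.Ventures.HodgeRepro2.T5LevelIdempotentTensor
import Summits.Ventures.HodgeRepro2.T5LevelConjugation

/-!
# `e_{K₁ × K₂} = e_{K₁} ⊗ e_{K₂}` on an external tensor product (Tier-5 kernel support, p8)

On the external tensor product `ρ₁ ⊠ ρ₂` of `G₁ × G₂` (Mathlib's `tprod` of the pull-backs,
written out as in `T5LevelIdempotentTensor`), the level idempotent of `K₁ × K₂` is the tensor
product of the level idempotents: `e_{K₁ × K₂} (v ⊗ w) = e_{K₁} v ⊗ e_{K₂} w`
(`levelAverage_prod_tmul`) and `e_{K₁ × K₂} = map e_{K₁} e_{K₂}` as linear maps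
(`levelIdempotent_prod_eq_map`), for `K`-finite `ρ₁`, `ρ₂` and `ρ₁ ⊠ ρ₂` in characteristic `0`.
The proof uses the two-property characterisation of the level average
(`T5LevelConjugation.levelAverage_eq_of_mem_of_sub_mem`): the candidate is `K₁ × K₂`-invariant
and differs from `v ⊗ w` by an element of the augmentation submodule.  Nothing is asserted about
any specific group.
-/

namespace Summit.Ventures.HodgeRepro2.T5LevelIdempotentTensorProd

open Summit.Ventures.HodgeRepro2.LevelPositivity Summit.Ventures.HodgeRepro2.T5LevelIdempotent
  Summit.Ventures.HodgeRepro2.T5LevelCoinvariants Summit.Ventures.HodgeRepro2.T5LevelIdempotentTensor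
  Summit.Ventures.HodgeRepro2.T5LevelConjugation
open TensorProduct
open Representation (Coinvariants)

variable {G₁ G₂ : Type*} [Group G₁] [Group G₂] {k : Type*} [Field k] [CharZero k]
  {V₁ : Type*} [AddCommGroup V₁] [Module k V₁] {V₂ : Type*} [AddCommGroup V₂] [Module k V₂]
  (ρ₁ : Representation k G₁ V₁) (ρ₂ : Representation k G₂ V₂) {K₁ : Subgroup G₁} {K₂ : Subgroup G₂}

omit [CharZero k] in
/-- `v ⊗ w − v' ⊗ w ∈ V(K₁ × K₂)` when `v − v' ∈ V₁(K₁)`. -/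
theorem tmul_sub_mem_coinvariantsKer_left {v v' : V₁} (h : v - v' ∈ Coinvariants.ker (restrict ρ₁ K₁))
    (w : V₂) :
    v ⊗ₜ[k] w - v' ⊗ₜ[k] w ∈ Coinvariants.ker (restrict (Representation.tprod
      (MonoidHom.comp ρ₁ (MonoidHom.fst G₁ G₂)) (MonoidHom.comp ρ₂ (MonoidHom.snd G₁ G₂)))
      (K₁.prod K₂)) := by
  rw [← sub_tmul]
  have hle : (Coinvariants.ker (restrict ρ₁ K₁)).map ((TensorProduct.mk k V₁ V₂).flip w) ≤
      Coinvariants.ker (restrict (Representation.tprod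
        (MonoidHom.comp ρ₁ (MonoidHom.fst G₁ G₂)) (MonoidHom.comp ρ₂ (MonoidHom.snd G₁ G₂)))
        (K₁.prod K₂)) := by
    rw [Coinvariants.ker, Submodule.map_span_le]
    rintro _ ⟨⟨κ, x⟩, rfl⟩
    have h' : ((TensorProduct.mk k V₁ V₂).flip w) ((restrict ρ₁ K₁) κ x - x) =
        (Representation.tprod (MonoidHom.comp ρ₁ (MonoidHom.fst G₁ G₂))
          (MonoidHom.comp ρ₂ (MonoidHom.snd G₁ G₂))) ((κ : G₁), (1 : G₂)) (x ⊗ₜ[k] w) -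
          x ⊗ₜ[k] w := by
      rw [map_sub, extTprod_apply, map_tmul, map_one, Module.End.one_apply]
      rfl
    rw [h']
    exact sub_mem_coinvariantsKer _ (Subgroup.mem_prod.2 ⟨κ.2, K₂.one_mem⟩) _
  exact hle (Submodule.mem_map_of_mem h)

omit [CharZero k] in
/-- `v ⊗ w − v ⊗ w' ∈ V(K₁ × K₂)` when `w − w' ∈ V₂(K₂)`. -/
theorem tmul_sub_mem_coinvariantsKer_right (v : V₁) {w w' : V₂}
    (h : w - w' ∈ Coinvariants.ker (restrict ρ₂ K₂)) :
    v ⊗ₜ[k] w - v ⊗ₜ[k] w' ∈ Coinvariants.ker (restrict (Representation.tprod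
      (MonoidHom.comp ρ₁ (MonoidHom.fst G₁ G₂)) (MonoidHom.comp ρ₂ (MonoidHom.snd G₁ G₂)))
      (K₁.prod K₂)) := by
  rw [← tmul_sub]
  have hle : (Coinvariants.ker (restrict ρ₂ K₂)).map (TensorProduct.mk k V₁ V₂ v) ≤
      Coinvariants.ker (restrict (Representation.tprod
        (MonoidHom.comp ρ₁ (MonoidHom.fst G₁ G₂)) (MonoidHom.comp ρ₂ (MonoidHom.snd G₁ G₂)))
        (K₁.prod K₂)) := by
    rw [Coinvariants.ker, Submodule.map_span_le]
    rintro _ ⟨⟨κ, x⟩, rfl⟩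
    have h' : (TensorProduct.mk k V₁ V₂ v) ((restrict ρ₂ K₂) κ x - x) =
        (Representation.tprod (MonoidHom.comp ρ₁ (MonoidHom.fst G₁ G₂))
          (MonoidHom.comp ρ₂ (MonoidHom.snd G₁ G₂))) ((1 : G₁), (κ : G₂)) (v ⊗ₜ[k] x) -
          v ⊗ₜ[k] x := by
      rw [map_sub, extTprod_apply, map_tmul, map_one, Module.End.one_apply]
      rfl
    rw [h']
    exact sub_mem_coinvariantsKer _ (Subgroup.mem_prod.2 ⟨K₁.one_mem, κ.2⟩) _
  exact hle (Submodule.mem_map_of_mem h)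

/-- `e_{K₁ × K₂} (v ⊗ w) = e_{K₁} v ⊗ e_{K₂} w` (`K`-finite `ρ₁`, `ρ₂`, `ρ₁ ⊠ ρ₂`, char `0`). -/
theorem levelAverage_prod_tmul (hK₁ : KFinite ρ₁ K₁) (hK₂ : KFinite ρ₂ K₂)
    (hK : KFinite (Representation.tprod (MonoidHom.comp ρ₁ (MonoidHom.fst G₁ G₂))
      (MonoidHom.comp ρ₂ (MonoidHom.snd G₁ G₂))) (K₁.prod K₂)) (v : V₁) (w : V₂) :
    levelAverage (Representation.tprod (MonoidHom.comp ρ₁ (MonoidHom.fst G₁ G₂))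
        (MonoidHom.comp ρ₂ (MonoidHom.snd G₁ G₂))) (K₁.prod K₂) (v ⊗ₜ[k] w) =
      levelAverage ρ₁ K₁ v ⊗ₜ[k] levelAverage ρ₂ K₂ w := by
  haveI := hK₁ v
  haveI := hK₂ w
  refine levelAverage_eq_of_mem_of_sub_mem _ hK ?_ ?_
  · rw [mem_invariants_prod_iff]
    refine ⟨fun κ hκ => ?_, fun κ hκ => ?_⟩
    · rw [map_tmul, LinearMap.id_apply, apply_levelAverage (ρ := ρ₁) (⟨κ, hκ⟩ : K₁)]
    · rw [map_tmul, LinearMap.id_apply, apply_levelAverage (ρ := ρ₂) (⟨κ, hκ⟩ : K₂)]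
  · have hdecomp : v ⊗ₜ[k] w - levelAverage ρ₁ K₁ v ⊗ₜ[k] levelAverage ρ₂ K₂ w =
        (v ⊗ₜ[k] w - levelAverage ρ₁ K₁ v ⊗ₜ[k] w) +
          (levelAverage ρ₁ K₁ v ⊗ₜ[k] w - levelAverage ρ₁ K₁ v ⊗ₜ[k] levelAverage ρ₂ K₂ w) := by
      abel
    rw [hdecomp]
    refine Submodule.add_mem _ ?_ ?_
    · exact tmul_sub_mem_coinvariantsKer_left ρ₁ ρ₂
        (sub_levelAverage_mem_coinvariantsKer ρ₁ (K := K₁) (v := v)) w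
    · exact tmul_sub_mem_coinvariantsKer_right ρ₁ ρ₂ _
        (sub_levelAverage_mem_coinvariantsKer ρ₂ (K := K₂) (v := w))

/-- `e_{K₁ × K₂} = e_{K₁} ⊗ e_{K₂}` as linear maps on `V₁ ⊗ V₂`. -/
theorem levelIdempotent_prod_eq_map (hK₁ : KFinite ρ₁ K₁) (hK₂ : KFinite ρ₂ K₂)
    (hK : KFinite (Representation.tprod (MonoidHom.comp ρ₁ (MonoidHom.fst G₁ G₂))
      (MonoidHom.comp ρ₂ (MonoidHom.snd G₁ G₂))) (K₁.prod K₂)) :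
    levelIdempotent (K₁.prod K₂) hK =
      map (levelIdempotent K₁ hK₁) (levelIdempotent K₂ hK₂) := by
  apply TensorProduct.ext'
  intro v w
  rw [levelIdempotent_apply, map_tmul, levelIdempotent_apply, levelIdempotent_apply,
    levelAverage_prod_tmul ρ₁ ρ₂ hK₁ hK₂ hK]

end Summit.Ventures.HodgeRepro2.T5LevelIdempotentTensorProd
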